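import Literature.AnabelianGeometry.AbsoluteAnabelian.GaloisCyclotomeH2TowerBridge
import Literature.AnabelianGeometry.AbsoluteAnabelian.MonoidKummerModelH2
import HarnessLib

/-!
# [AbsTopIII] Cor. 1.10 (i)(a) / Prop. 3.2 (i), Rmk. 3.2.1: the two towers computing `H²(G_K, Ẑ(1)) ≅ Ẑ` agree

S. Mochizuki, *Topics in Absolute Anabelian Geometry III* (kurims render `url-5493eb38cbb7`): Cor. 1.10 (i)(a)
p. 42 «the natural isomorphism `H²(G_k, μ_Ẑ(G_k)) ⥲ Ẑ`»; Prop. 3.2 (i) p. 71 «`H²(G, μ_Ẑ(M_TM)) ⥲ Ẑ`»; Rmk. 3.2.1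
p. 73 l. 5–15 «by imposing the condition of compatibility with the natural isomorphism of Corollary 1.10 (a)».
The tree holds TWO kernel constructions of the chain `H²_cont(G_K, lim_n μ_n) ≅ lim_n H²(G_K, μ_n) ≅ Ẑ` for a
`p`-adic local field `K`:
* (α) abc-iut-L4-t11/t16: `continuousCohomologyTwoTateModuleEquiv K : H²(tateModuleMu K) ≃+ (muSystem K).cohomologyLimit 2`
  followed by `cohomologyLimitMuEquivZHat` (levels `invMap K n`; `RootsOfUnityInverseLimit.lean`,
  `LocalTateModuleH2.lean`), which IS the `h2Iso` of the all-slots-real MODEL Kummer theory of Prop. 3.2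
  (abc-iut-L4-t2, `MLFClosure.galH2EquivZhat`, `kummerTheoryStd_h2Iso`, `MonoidKummerModelH2.lean`);
* (β) abc-iut-L4-t17: `galCyclotomeTower` / `DiscreteTowerPresentation.limitClassesEquiv` followed by
  `limitClassesEquivZModChain` (levels `Prop121vii.invLevel`; `CyclotomicSynchronizationCor110iaProofs.lean`,
  F-1387 `AbsTopIII.Cor_1_10_i_a_holds`), read on all levels `n ≥ 1` by `GaloisCyclotomeH2TowerBridge.lean`.
This file is the JUNCTION (proof + one comparison morphism, no new notion):
* `muSystem_redHom_eq_muPowHomOfDvd`, **`H2PowCompatible_eq_cohomologyLimit`** — the two inverse systems of the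
  `H²(G_K, μ_n)` are the SAME additive subgroup of `∏_{n ≥ 1} H²(G_K, μ_n)`;
* **`invMap_eq_invLevel`** — both lineages normalise by THE unique invariant map of local class field theory,
  so (α)'s `Ẑ`-value has level-`n` residue `inv_n` (`toAdd_level_cohomologyLimitMuToZHat_eq_invLevel`) and
  agrees with (β)'s `zmodChain`-value at every factorial level (`level_cohomologyLimitMuToZHat_eq_zmodChain`);
* **`galCyclotomeToTateModule φ hφ : μ_Ẑ(G_K) ⟶ Ẑ(1)`** — the coefficient comparison `z ↦ (φ(z_n))_n` (given the
  equivariant `φ : μ_{ℚ/ℤ}(G_K) ≅ μ(K̄)` of Rmk. 3.2.1 / [AbsAnab] Prop. 1.2.1 (vi)), a morphism of topological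
  representations compatible with the projections (`projHom_hom_galCyclotomeToTateModule`), bijective
  (`galCyclotomeToTateModule_bijective`); hence `H²(ψ)` intertwines (β)'s `galCyclotomeH2EquivPowCompatible`
  with (α)'s `continuousCohomologyTwoTateModuleEquiv` (`twoTateModuleEquiv_cohomologyMap_galCyclotomeToTateModule`)
  and **the model `h2Iso` of Prop. 3.2 (i) transported along `H²(ψ)` has the residues of Cor. 1.10 (i)(a)'s
  chain at every level** (`toAdd_level_galH2EquivZhat_cohomologyMap`, `level_galH2EquivZhat_eq_limitClassesEquivZModChain`).
HONEST FRAMING: classical, undisputed bookkeeping (abc-iut cell, layer L4, sub-DAG [AbsTopIII] Prop. 3.2 (i) row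
L06 «two real H²'s» junction); nothing here bears on [IUTchIII] Cor. 3.12; no side taken.

## References
* [MochizukiAbsTopIII2015] S. Mochizuki, *Topics in Absolute Anabelian Geometry III*, Cor. 1.10 (i) p. 42,
  Prop. 3.2 (i) p. 71, Rmk. 3.2.1 p. 73.
* [NeukirchSchmidtWingberg2008] J. Neukirch, A. Schmidt, K. Wingberg, *Cohomology of Number Fields*, (2.7.5), (7.2.6).
-/

noncomputable section

open CategoryTheory Function

universe u

namespace Literature.AnabelianGeometry.AbsoluteAnabelian

open Field
open Literature.NumberTheory.GaloisRepresentations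
open Literature.NumberTheory.GaloisRepresentations.DiscreteGaloisModule
open Literature.AnabelianGeometry.EtaleTheta.ZHatLevel

/-! ### The two inverse systems of the `H²(G_K, μ_n)` coincide -/

section Systems

variable (K : Type u) [Field K]

/-- The transition maps agree: abc-iut-L4-t11's `(muSystem K).redHom` (`muPowMap`) and abc-iut-L4-t17's
`muPowHom` in its canonical-exponent form `muPowHomOfDvd` are the same morphism `μ_N(K̄) → μ_n(K̄)`,
`ζ ↦ ζ^{N/n}`. [cite: NeukirchSchmidtWingberg2008, Thm (2.7.5)] -/
theorem muSystem_redHom_eq_muPowHomOfDvd {n N : ℕ+} (h : (n : ℕ) ∣ (N : ℕ)) :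
    (muSystem K).redHom h = muPowHomOfDvd K h :=
  TopRep.hom_ext (ContIntertwiningMap.ext (ContinuousLinearMap.ext fun v =>
    muVal_injective K n (by
      change muVal K n ((muSystem K).red h v) = muVal K n ((muPowHomOfDvd K h).hom v)
      rw [muSystem_red, muVal_muPowMap, muVal_muPowHomOfDvd_hom])))

/-- **`lim_{n ≥ 1} H²(G_K, μ_n)` once**: the divisibility-indexed inverse system `H2PowCompatible K` of
`GaloisCyclotomeH2TowerBridge.lean` IS abc-iut-L4-t11's `(muSystem K).cohomologyLimit 2` (same additive
subgroup of `∏_{n ≥ 1} H²(G_K, μ_n)`). [cite: NeukirchSchmidtWingberg2008, Thm (2.7.5)] -/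
theorem H2PowCompatible_eq_cohomologyLimit : H2PowCompatible K = (muSystem K).cohomologyLimit 2 := by
  ext c
  rw [mem_H2PowCompatible_iff, DiscreteInvSystem.mem_cohomologyLimit_iff]
  constructor
  · intro hc n N h
    change (cohomologyMap ((muSystem K).redHom h) 2).hom (c N) = c n
    rw [muSystem_redHom_eq_muPowHomOfDvd]
    exact hc h
  · intro hc n N h
    rw [← muSystem_redHom_eq_muPowHomOfDvd]
    exact hc h

/-- The identification as an additive equivalence (identity on components).
[cite: NeukirchSchmidtWingberg2008, Thm (2.7.5)] -/
def h2PowCompatibleEquivCohomologyLimit : H2PowCompatible K ≃+ (muSystem K).cohomologyLimit 2 :=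
  AddEquiv.addSubgroupCongr (H2PowCompatible_eq_cohomologyLimit K)

/-- Components are unchanged. [cite: NeukirchSchmidtWingberg2008, Thm (2.7.5)] -/
@[simp] theorem h2PowCompatibleEquivCohomologyLimit_apply_coe (c : H2PowCompatible K) (n : ℕ+) :
    (h2PowCompatibleEquivCohomologyLimit K c : ∀ n, continuousCohomology 2 ((muSystem K).ρ n).toTopRep) n =
      (c : ∀ n : ℕ+, continuousCohomology 2 (mu K (n : ℕ)).toTopRep) n := rfl

end Systems

/-! ### The coefficient comparison `μ_Ẑ(G_K) → Ẑ(1) = lim_n μ_n(K̄)` -/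

section Coefficients

variable {K : Type u} [Field K] [CharZero K]

variable (φ : muQZ (absoluteGaloisGroup K) ≃+ Additive (CommGroup.torsion (AlgebraicClosure K)ˣ))
  (hφ : ∀ (σ : absoluteGaloisGroup K) (x : muQZ (absoluteGaloisGroup K)),
    (((Additive.toMul (φ (σ • x)) : CommGroup.torsion (AlgebraicClosure K)ˣ) :
        (AlgebraicClosure K)ˣ) : AlgebraicClosure K) =
      σ • (((Additive.toMul (φ x) : CommGroup.torsion (AlgebraicClosure K)ˣ) :
        (AlgebraicClosure K)ˣ) : AlgebraicClosure K))

/-- `z ↦ (φ(z_n))_n`: the family of ALL finite-level projections of `z ∈ μ_Ẑ(G_K)` is a compatible family,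
i.e. an element of `Ẑ(1) = lim_n μ_n(K̄)` (abc-iut-L4-t11's `(muSystem K).limit`).
[cite: MochizukiAbsTopIII2015, Remark 3.2.1 p.73] -/
def galCyclotomeToTateFun (z : MuZhatMod (absoluteGaloisGroup K)) : (muSystem K).limit :=
  ⟨fun n => cycProjFun φ n z, fun n N h => muVal_injective K n (by
    rw [muSystem_red, muVal_muPowMap, muVal_cycProjFun, muVal_cycProjFun,
      componentUnit_eq_pow_of_dvd φ h])⟩

/-- Components of `galCyclotomeToTateFun`. [cite: MochizukiAbsTopIII2015, Remark 3.2.1 p.73] -/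
@[simp] theorem galCyclotomeToTateFun_coe (z : MuZhatMod (absoluteGaloisGroup K)) (n : ℕ+) :
    (galCyclotomeToTateFun φ z : ∀ n : ℕ+, MuCarrier K n) n = cycProjFun φ n z := rfl

/-- `galCyclotomeToTateFun` is additive. [cite: MochizukiAbsTopIII2015, Remark 3.2.1 p.73] -/
def galCyclotomeToTateAddHom : MuZhatMod (absoluteGaloisGroup K) →+ (muSystem K).limit where
  toFun := galCyclotomeToTateFun φ
  map_zero' := Subtype.ext (funext fun n => map_zero (cycProjAddHom φ n))
  map_add' z z' := Subtype.ext (funext fun n => map_add (cycProjAddHom φ n) z z')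

/-- `galCyclotomeToTateFun` is continuous (each component is the continuous `cycProjFun`).
[cite: MochizukiAbsTopIII2015, Remark 3.2.1 p.73] -/
theorem continuous_galCyclotomeToTateFun : Continuous (galCyclotomeToTateFun (K := K) φ) :=
  continuous_induced_rng.2 (continuous_pi fun n => continuous_cycProjFun φ n)

include hφ in
/-- **The coefficient comparison `ψ : μ_Ẑ(G_K) ⟶ Ẑ(1)`** as a morphism of topological representations of
`G_K` (continuous, additive, equivariant by the equivariance of `φ`): Rmk. 3.2.1's identification of the
group-theoretic cyclotome with the Tate module of the roots of unity, at the level of the tree's two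
realisations (abc-iut-L4-t1 `galCyclotomeTopRep`, abc-iut-L4-t11 `tateModuleMu`).
[cite: MochizukiAbsTopIII2015, Remark 3.2.1 p.73] -/
def galCyclotomeToTateModule :
    galCyclotomeTopRep (absoluteGaloisGroup K) ⟶ (tateModuleMu K).toTopRep :=
  TopRep.ofHom ⟨⟨(galCyclotomeToTateAddHom φ).toIntLinearMap, continuous_galCyclotomeToTateFun φ⟩,
    fun σ => by
      ext z n
      apply muVal_injective K n
      change muVal K n (cycProjFun φ n (galCyclotomeRep (absoluteGaloisGroup K) σ z)) =
        muVal K n (mu K n σ (cycProjFun φ n z))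
      rw [muVal_apply, muVal_cycProjFun, muVal_cycProjFun, componentUnit_smul φ hφ]⟩

/-- `ψ` on elements: the `n`-th coordinate is `φ(z_n)`. [cite: MochizukiAbsTopIII2015, Remark 3.2.1 p.73] -/
@[simp] theorem galCyclotomeToTateModule_hom_apply_coe (z : MuZhatMod (absoluteGaloisGroup K)) (n : ℕ+) :
    ((galCyclotomeToTateModule φ hφ).hom z : ∀ n : ℕ+, MuCarrier K n) n = cycProjFun φ n z := rfl

/-- **Compatibility with the projections**: `proj_n ∘ ψ = cycProj_n`.
[cite: MochizukiAbsTopIII2015, Remark 3.2.1 p.73] -/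
theorem projHom_hom_galCyclotomeToTateModule (n : ℕ+) (z : MuZhatMod (absoluteGaloisGroup K)) :
    ((muSystem K).projHom n).hom ((galCyclotomeToTateModule φ hφ).hom z) = (cycProj φ hφ n).hom z := rfl

/-- `ψ` is injective: an element of `μ_Ẑ(G_K)` is determined by its finite-level components.
[cite: MochizukiAbsTopIII2015, Remark 3.2.1 p.73] -/
theorem galCyclotomeToTateModule_injective : Injective (galCyclotomeToTateModule φ hφ).hom := by
  intro z z' h
  have hc : ∀ n, componentUnit φ n z = componentUnit φ n z' := fun n => by
    rw [← muVal_cycProjFun φ, ← muVal_cycProjFun φ]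
    exact congrArg (fun x : (muSystem K).limit => muVal K n ((x : ∀ n : ℕ+, MuCarrier K n) n)) h
  have hz : z.toMuZhat = z'.toMuZhat :=
    Subtype.ext (funext fun n => eq_of_coe_toMul_φ_eq φ (hc n))
  exact congrArg MuZhatMod.ofMuZhat hz

/-- The candidate preimage of a compatible family `x ∈ lim_n μ_n(K̄)`: `n ↦ φ⁻¹(x_n)`.
[cite: MochizukiAbsTopIII2015, Remark 3.2.1 p.73] -/
def tateLiftFun (x : (muSystem K).limit) (n : ℕ+) : Multiplicative (muQZ (absoluteGaloisGroup K)) :=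
  Multiplicative.ofAdd (φ.symm (Additive.ofMul ⟨muVal K n ((x : ∀ n : ℕ+, MuCarrier K n) n),
    (CommGroup.mem_torsion _).2 (isOfFinOrder_iff_pow_eq_one.2 ⟨n, n.pos, muVal_pow_eq_one K _ _⟩)⟩))

/-- The `φ`-image of `tateLiftFun x n` is `x_n`. [cite: MochizukiAbsTopIII2015, Remark 3.2.1 p.73] -/
theorem coe_toMul_φ_tateLiftFun (x : (muSystem K).limit) (n : ℕ+) :
    ((Additive.toMul (φ (Multiplicative.toAdd (tateLiftFun φ x n))) :
      CommGroup.torsion (AlgebraicClosure K)ˣ) : (AlgebraicClosure K)ˣ) =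
        muVal K n ((x : ∀ n : ℕ+, MuCarrier K n) n) := by
  simp [tateLiftFun]

omit [CharZero K] in
/-- Compatibility of a family in `lim_n μ_n(K̄)` read on units: `x_N^{N/n} = x_n` for `n ∣ N`.
[cite: NeukirchSchmidtWingberg2008, Thm (2.7.5)] -/
theorem muVal_limit_pow_div (x : (muSystem K).limit) {n N : ℕ+} (h : (n : ℕ) ∣ (N : ℕ)) :
    muVal K N ((x : ∀ n : ℕ+, MuCarrier K n) N) ^ ((N : ℕ) / n) =
      muVal K n ((x : ∀ n : ℕ+, MuCarrier K n) n) := by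
  have hx := congrArg (muVal K n) (x.2 h)
  rwa [muSystem_red, muVal_muPowMap] at hx

omit [CharZero K] in
/-- Compatibility of a family in `lim_n μ_n(K̄)` read on units: `x_{nm}^m = x_n`.
[cite: NeukirchSchmidtWingberg2008, Thm (2.7.5)] -/
theorem muVal_limit_mul_pow (x : (muSystem K).limit) (n m : ℕ+) :
    muVal K ((n * m : ℕ+) : ℕ) ((x : ∀ n : ℕ+, MuCarrier K n) (n * m)) ^ (m : ℕ) =
      muVal K n ((x : ∀ n : ℕ+, MuCarrier K n) n) := by
  have he : ((n * m : ℕ+) : ℕ) / n = m := by rw [PNat.mul_coe, Nat.mul_div_cancel_left _ n.pos]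
  rw [← muVal_limit_pow_div x (⟨m, PNat.mul_coe n m⟩ : (n : ℕ) ∣ ((n * m : ℕ+) : ℕ)), he]

/-- The candidate preimage lies in `μ_Ẑ(G_K)`. [cite: MochizukiAbsTopIII2015, Remark 3.2.1 p.73] -/
theorem tateLiftFun_mem (x : (muSystem K).limit) : tateLiftFun φ x ∈ muZhat (absoluteGaloisGroup K) := by
  refine (mem_muZhat_iff (absoluteGaloisGroup K) _).2 ⟨fun n => ?_, fun n m => ?_⟩
  · apply eq_of_coe_toMul_φ_eq φ
    rw [coe_toMul_φ_pow, coe_toMul_φ_tateLiftFun, muVal_pow_eq_one]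
    simp
  · apply eq_of_coe_toMul_φ_eq φ
    rw [coe_toMul_φ_pow, coe_toMul_φ_tateLiftFun, coe_toMul_φ_tateLiftFun, muVal_limit_mul_pow]

/-- The preimage as an element of `μ_Ẑ(G_K)`. [cite: MochizukiAbsTopIII2015, Remark 3.2.1 p.73] -/
def tateLift (x : (muSystem K).limit) : MuZhatMod (absoluteGaloisGroup K) :=
  MuZhatMod.ofMuZhat ⟨tateLiftFun φ x, tateLiftFun_mem φ x⟩

/-- The preimage has the prescribed components. [cite: MochizukiAbsTopIII2015, Remark 3.2.1 p.73] -/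
theorem componentUnit_tateLift (x : (muSystem K).limit) (n : ℕ+) :
    componentUnit φ n (tateLift φ x) = muVal K n ((x : ∀ n : ℕ+, MuCarrier K n) n) :=
  coe_toMul_φ_tateLiftFun φ x n

/-- `ψ` is surjective: every compatible family of roots of unity comes from `μ_Ẑ(G_K)`.
[cite: MochizukiAbsTopIII2015, Remark 3.2.1 p.73] -/
theorem galCyclotomeToTateModule_surjective : Surjective (galCyclotomeToTateModule φ hφ).hom := fun x =>
  ⟨tateLift φ x, Subtype.ext (funext fun n => muVal_injective K n (by
    change muVal K n (cycProjFun φ n (tateLift φ x)) = _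
    rw [muVal_cycProjFun, componentUnit_tateLift]))⟩

/-- **`ψ : μ_Ẑ(G_K) ⥲ Ẑ(1)` is bijective** (an isomorphism of the underlying Galois modules).
[cite: MochizukiAbsTopIII2015, Remark 3.2.1 p.73] -/
theorem galCyclotomeToTateModule_bijective : Bijective (galCyclotomeToTateModule φ hφ).hom :=
  ⟨galCyclotomeToTateModule_injective φ hφ, galCyclotomeToTateModule_surjective φ hφ⟩

/-- On `H²`: `H²(proj_n) ∘ H²(ψ) = H²(cycProj_n)`. [cite: MochizukiAbsTopIII2015, Remark 3.2.1 p.73] -/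
theorem cohomologyMap_projHom_galCyclotomeToTateModule (n : ℕ+) (q : ℕ)
    (y : continuousCohomology q (galCyclotomeTopRep (absoluteGaloisGroup K))) :
    (cohomologyMap ((muSystem K).projHom n) q).hom ((cohomologyMap (galCyclotomeToTateModule φ hφ) q).hom y) =
      (cohomologyMap (cycProj φ hφ n) q).hom y :=
  (cohomologyMap_hom_apply_of_comp (galCyclotomeToTateModule φ hφ) ((muSystem K).projHom n) (cycProj φ hφ n)
    (fun _ => rfl) q y).symm

end Coefficients

/-! ### The `p`-adic case: one normalisation, one answer -/

section MLF

variable (K : Type u) [Field K] [ValuativeRel K] [TopologicalSpace K] [IsNonarchimedeanLocalField K]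
  [CharZero K]

/-- **One normalisation**: abc-iut-L4-t11's chosen invariant maps `invMap K n` and the residue maps
`Prop121vii.invLevel K n` of abc-iut-L4-t17's chain are equal — both are THE unique invariant map of local
class field theory (`eq_invLevel`). [cite: MochizukiAbsTopIII2015, Cor 1.10 (i) p.42] -/
theorem invMap_eq_invLevel (n : ℕ+) : invMap K n = Prop121vii.invLevel K n :=
  Prop121vii.eq_invLevel K (isInvariantMap_invMap K n)

/-- Levels of (α)'s comparison map `lim_n H²(G_K, μ_n) → Ẑ` are the residues `inv_n`.
[cite: MochizukiAbsTopIII2015, Cor 1.10 (i) p.42] -/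
theorem toAdd_level_cohomologyLimitMuToZHat_eq_invLevel (x : (muSystem K).cohomologyLimit 2) (n : ℕ+) :
    Multiplicative.toAdd (level n (Additive.toMul (cohomologyLimitMuToZHat K x))) =
      Prop121vii.invLevel K n ((x : ∀ n, continuousCohomology 2 ((muSystem K).ρ n).toTopRep) n) := by
  rw [toAdd_level_cohomologyLimitMuToZHat, invMap_eq_invLevel]

variable (φ : muQZ (absoluteGaloisGroup K) ≃+ Additive (CommGroup.torsion (AlgebraicClosure K)ˣ))
  (hφ : ∀ (σ : absoluteGaloisGroup K) (x : muQZ (absoluteGaloisGroup K)),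
    (((Additive.toMul (φ (σ • x)) : CommGroup.torsion (AlgebraicClosure K)ˣ) :
        (AlgebraicClosure K)ˣ) : AlgebraicClosure K) =
      σ • (((Additive.toMul (φ x) : CommGroup.torsion (AlgebraicClosure K)ˣ) :
        (AlgebraicClosure K)ˣ) : AlgebraicClosure K))

/-- **(α) and (β) agree at every factorial level on the common inverse system**: for a power-compatible family
`c`, the level-`(i+1)!` residue of (α)'s `Ẑ`-value (`cohomologyLimitMuToZHat`) is the `i`-th component of (β)'s
`zmodChain`-value (abc-iut-L4-t17's `limitClassesEquivZModChain` on the restricted family).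
[cite: MochizukiAbsTopIII2015, Cor 1.10 (i) p.42] -/
theorem level_cohomologyLimitMuToZHat_eq_zmodChain (c : H2PowCompatible K) (i : ℕ) :
    Multiplicative.toAdd (level (cycLevel i)
        (Additive.toMul (cohomologyLimitMuToZHat K (h2PowCompatibleEquivCohomologyLimit K c)))) =
      (limitClassesEquivZModChain K φ hφ (h2PowCompatibleRestrict φ hφ c)).1 i := by
  rw [toAdd_level_cohomologyLimitMuToZHat_eq_invLevel, limitClassesEquivZModChain_restrict_coe]
  rfl

/-- **`H²(ψ)` intertwines the two tower equivalences**: for `y ∈ H²(G_K, μ_Ẑ(G_K))`, (α)'s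
`continuousCohomologyTwoTateModuleEquiv` of `H²(ψ) y` is (β)'s `galCyclotomeH2EquivPowCompatible` of `y`
(componentwise `H²(proj_n) H²(ψ) y = H²(cycProj_n) y`). [cite: MochizukiAbsTopIII2015, Remark 3.2.1 p.73] -/
theorem twoTateModuleEquiv_cohomologyMap_galCyclotomeToTateModule (y : galCyclotomeH2 (absoluteGaloisGroup K)) :
    continuousCohomologyTwoTateModuleEquiv K ((cohomologyMap (galCyclotomeToTateModule φ hφ) 2).hom y) =
      h2PowCompatibleEquivCohomologyLimit K (galCyclotomeH2EquivPowCompatible K φ hφ y) := by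
  refine Subtype.ext (funext fun n => ?_)
  rw [h2PowCompatibleEquivCohomologyLimit_apply_coe, galCyclotomeH2EquivPowCompatible_apply_coe]
  exact cohomologyMap_projHom_galCyclotomeToTateModule φ hφ n 2 y

/-- **The model `h2Iso` along `H²(ψ)` has the residues of Cor. 1.10 (i)(a)'s chain**: the level-`n` component of
`cohomologyLimitMuEquivZHat (continuousCohomologyTwoTateModuleEquiv (H²(ψ) y))` is `inv_n (H²(cycProj_n) y)`,
for every `n ≥ 1`. [cite: MochizukiAbsTopIII2015, Remark 3.2.1 p.73] -/
theorem toAdd_level_galH2EquivZhat_cohomologyMap (y : galCyclotomeH2 (absoluteGaloisGroup K)) (n : ℕ+) :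
    Multiplicative.toAdd (level n (Additive.toMul (cohomologyLimitMuEquivZHat K
        (continuousCohomologyTwoTateModuleEquiv K ((cohomologyMap (galCyclotomeToTateModule φ hφ) 2).hom y))))) =
      Prop121vii.invLevel K n ((cohomologyMap (cycProj φ hφ n) 2).hom y) := by
  rw [twoTateModuleEquiv_cohomologyMap_galCyclotomeToTateModule]
  change Multiplicative.toAdd (level n (Additive.toMul (cohomologyLimitMuToZHat K _))) = _
  rw [toAdd_level_cohomologyLimitMuToZHat_eq_invLevel, h2PowCompatibleEquivCohomologyLimit_apply_coe,
    galCyclotomeH2EquivPowCompatible_apply_coe]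

/-- **Junction with F-1387's construction**: at every factorial level `(i+1)!`, the model `h2Iso` along `H²(ψ)`
((α), abc-iut-L4-t2/t11) and abc-iut-L4-t17's `limitClassesEquivZModChain ∘ limitClassesEquiv` ((β), the chain
behind `AbsTopIII.Cor_1_10_i_a_holds`) give the same residue. [cite: MochizukiAbsTopIII2015, Remark 3.2.1 p.73] -/
theorem level_galH2EquivZhat_eq_limitClassesEquivZModChain (y : galCyclotomeH2 (absoluteGaloisGroup K)) (i : ℕ) :
    Multiplicative.toAdd (level (cycLevel i) (Additive.toMul (cohomologyLimitMuEquivZHat K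
        (continuousCohomologyTwoTateModuleEquiv K ((cohomologyMap (galCyclotomeToTateModule φ hφ) 2).hom y))))) =
      (limitClassesEquivZModChain K φ hφ
        ((galCyclotomeTower φ hφ).limitClassesEquiv (finite_H1_galCyclotomeTower K φ hφ) y)).1 i := by
  rw [toAdd_level_galH2EquivZhat_cohomologyMap]
  rfl

end MLF

/-! ### The packaged model: `MLFClosure.galH2EquivZhat` (Prop. 3.2 (i) at the model) vs Cor. 1.10 (i)(a) -/

section Model

variable (C : MLFClosure.{0})

variable (φ : muQZ (absoluteGaloisGroup C.k) ≃+ Additive (CommGroup.torsion (AlgebraicClosure C.k)ˣ))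
  (hφ : ∀ (σ : absoluteGaloisGroup C.k) (x : muQZ (absoluteGaloisGroup C.k)),
    (((Additive.toMul (φ (σ • x)) : CommGroup.torsion (AlgebraicClosure C.k)ˣ) :
        (AlgebraicClosure C.k)ˣ) : AlgebraicClosure C.k) =
      σ • (((Additive.toMul (φ x) : CommGroup.torsion (AlgebraicClosure C.k)ˣ) :
        (AlgebraicClosure C.k)ˣ) : AlgebraicClosure C.k))

/-- **Rmk. 3.2.1 at the `H²` level for the model Kummer theory of Prop. 3.2**: the `h2Iso` of abc-iut-L4-t2's
all-slots-real model Kummer theory (`kummerTheoryStd_h2Iso = MLFClosure.galH2EquivZhat`), evaluated on the image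
under `H²(ψ)` of a class `y ∈ H²(G_k, μ_Ẑ(G_k))`, has level-`n` residue `inv_n (H²(cycProj_n) y)` — the residues of
Cor. 1.10 (i)(a)'s construction — for every `n ≥ 1`. [cite: MochizukiAbsTopIII2015, Remark 3.2.1 p.73] -/
theorem MLFClosure.toAdd_level_galH2EquivZhat_cohomologyMap (y : galCyclotomeH2 (absoluteGaloisGroup C.k))
    (n : ℕ+) :
    Multiplicative.toAdd (level n (Additive.toMul
        (C.galH2EquivZhat ((cohomologyMap (galCyclotomeToTateModule φ hφ) 2).hom y)).down)) =
      Prop121vii.invLevel C.k n ((cohomologyMap (cycProj φ hφ n) 2).hom y) :=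
  Literature.AnabelianGeometry.AbsoluteAnabelian.toAdd_level_galH2EquivZhat_cohomologyMap C.k φ hφ y n

/-- The same against abc-iut-L4-t17's chain at the factorial levels.
[cite: MochizukiAbsTopIII2015, Remark 3.2.1 p.73] -/
theorem MLFClosure.level_galH2EquivZhat_eq_limitClassesEquivZModChain
    (y : galCyclotomeH2 (absoluteGaloisGroup C.k)) (i : ℕ) :
    Multiplicative.toAdd (level (cycLevel i) (Additive.toMul
        (C.galH2EquivZhat ((cohomologyMap (galCyclotomeToTateModule φ hφ) 2).hom y)).down)) =
      (limitClassesEquivZModChain C.k φ hφ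
        ((galCyclotomeTower φ hφ).limitClassesEquiv (finite_H1_galCyclotomeTower C.k φ hφ) y)).1 i :=
  Literature.AnabelianGeometry.AbsoluteAnabelian.level_galH2EquivZhat_eq_limitClassesEquivZModChain C.k φ hφ y i

end Model

end Literature.AnabelianGeometry.AbsoluteAnabelian

end
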